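import Summits.BirchSwinnertonDyer.Rank1Residual.X10.ResidualSelmerGroup
import Literature.NumberTheory.EllipticCurves.SelmerFiniteProofs
import Literature.NumberTheory.GaloisRepresentations.LocalGlobalCohomologyDualityProofs
import HarnessLib

/-!
# The `E[p]` instance of the N2 parity law, PART I: the group-currency binders that are ALREADY
# theorems of the tree — `hL`, `hoff`, `hSel`, `hS0`, `hfin` (and `hH`, already landed) of
# `X10/ResidualSelmerParityGroupForm.even_add_add_card_groupForm`, discharged for
# `H = H¹(K, E[p])`, `X = ` the Kummer structure, `Λ = ` the residual structure, `Sel = Sel_p(E)`, `S0 = S⁰(E)`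
# (cell `b2b-bsdres`, unit `b2b-bsdres-x10` = N2 class lead, GEN 31; theorems only, no definition, no
# named fact, nothing booked — glue G1 (part), G5, G7, G9-binders of `class-closure/N2/P-INSTANCE-ASK-x10g31.md`)

HONEST FRAMING (run/shared/lean/b2b/bsd-rank1-residual/, verbatim in every file): the goal of the
cell is to DELETE the COMBINATION-SHAPED residual classes of the Birch–Swinnerton-Dyer formula for
ALL analytic-rank `≤ 1` elliptic curves over `ℚ` — "full BSD formula for every rank `≤ 1` curve in
class `C`" assembled STRICTLY from published theorems — so that the rank-`≤ 1` remainder becomes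
exactly the CONSTRUCTION-SHAPED classes, which are TYPED (missing-input `Prop`s), NOT attempted.
This is not "finishing BSD". Class X10b (= N2) keeps its label CONSTRUCTION-SHAPED (NEEDS `X_A3`,
referee R82.3 / RESIDUAL-MAP §I N2); this file is a TOOL; no mark / label / tier / count moves.

## What

The group-currency parity law (x10 GEN 31, `ResidualSelmerParityGroupForm`, held for its import chain)
takes data `H`, `L v`, `loc v : H →+ L v`, `Λ X : ∀ v, AddSubgroup (L v)` and two subgroups `Sel`,
`S0 ≤ H` described by MEMBERSHIP. The DICTIONARY of the instance (P-INSTANCE-ASK §1) chooses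
`H := H¹(K, E[p]) = galH1Torsion W p`, `L v := H¹(K_v, E[p])`, `loc v := galoisCohomology.localization`,
`X := W.kummerSelmerStructure p` (the Kummer conditions), and — the trick that avoids any new
definition — `Λ := residualSelmerStructure W p` (x10 GEN 31, `X10/ResidualSelmerGroup`: the unramified
subgroup at every finite `v ∤ p`, the Kummer condition above `p` and at `∞`, places which lie in `S₀`
where the value of `Λ` is never used). This file discharges, fact-free, every binder of the law that
is pure bookkeeping over tree theorems:

* §1 `hL`: `p • x = 0` on every `H¹(K_v, E[p])`
  (`galoisCohomology.nsmul_eq_zero_of_forall`, `AddSubgroup.torsionBy.nsmul`); `hH` (`p • c = 0` on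
  `H¹(K, E[p])`) is the tree's `Additive.smul_galH1Torsion_eq_zero` and is NOT restated.
* §2 `hoff`: at a finite `v ∤ p` with `p ∤ c_v(E)` — in particular at a good `v ∤ p` — the Kummer
  condition IS the residual (= unramified) condition (team n1011 (L1), LOCAL form).
* §3 `hSel`: for a finite set of places `S ⊇ {v ∣ ∞} ∪ {v ∣ p} ∪ {bad v}`,
  `c ∈ Sel_p(E) ↔ (∀ v ∈ S, loc_v c ∈ 𝓛_v) ∧ ∀ v ∉ S, loc_v c ∈ Λ_v`
  (`mem_selmerGroup_iff_forall_localization_mem` + §2 at the good places).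
* §4 `hS0`: for `P ⊇ {v ∣ ∞} ∪ {v ∣ p}` whose other members are Tamagawa-`p`-free,
  `c ∈ S⁰(E) ↔ (∀ v ∈ P, loc_v c ∈ 𝓛_v) ∧ ∀ v ∉ P, loc_v c ∈ Λ_v`.
* §5 `hfin`: the classes with `loc_v c ∈ Λ_v` for all `v ∉ S` are FINITE — they lie in Silverman's
  `H¹(G_K, E[p]; S_fin)` (`h1Unramified`, Lemma X.4.3 = the tree's PROVED `finite_h1Unramified_holds`)
  through n1011's (L1) `𝓢_v = unramifiedKer 𝔓` at the good places `v ∤ p` outside `S`.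

Left to the cohomological glue (ASK G2–G4, G6, G8): the pairing `b v` (local Tate ∘ Weil), `hsymm`,
`hnd`, `hΛ`, `hX`, `hrec`, `hPT`, the local term `#𝓛_v = p·#(𝓛_v ∩ H¹_ur)` at `p ∣ c_v`.

## References

* [MazurRubin2007] B. Mazur, K. Rubin, Ann. of Math. 166 (2007), Def. 1.2, Thm. 1.4.
* [SilvermanAEC2009] J. H. Silverman, *AEC*, Lemma X.4.3, Thm. X.4.2, Cor. X.4.4.
* [MilneADT2006] J. S. Milne, *ADT*, I Prop. 3.8, Rem. 3.10.
* HOME/class-closure/N2/P-INSTANCE-ASK-x10g31.md; HOME/X10-AUDIT.md §37.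
-/

set_option autoImplicit false

noncomputable section

open scoped Classical

open WeierstrassCurve Literature.NumberTheory.EllipticCurves Literature.NumberTheory.GaloisRepresentations
  NumberField IsDedekindDomain
open Literature.NumberTheory.GaloisRepresentations.DiscreteGaloisModule (unramifiedSubgroup SelmerStructure)
open Summit.BirchSwinnertonDyer.Rank1Residual.GaloisImage.InertiaDivisible
open Summit.BirchSwinnertonDyer.Rank1Residual.X10.SelmerCompanionsTamagawaFree
open Summit.BirchSwinnertonDyer.Rank1Residual.X10.ResidualSelmerGroup

namespace Summit.BirchSwinnertonDyer.Rank1Residual.X10.ResidualSelmerGroupBinders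

variable {K : Type} [Field K] [NumberField K] (W : WeierstrassCurve K) (p : ℕ)

/-! ### §1. `hL`: the local cohomology of `E[p]` is killed by `p` (`hH` is in the tree) -/

-- `hH` (`p • c = 0` for every `c ∈ H¹(K, E[p])`) is ALREADY the tree's
-- `Summit.BirchSwinnertonDyer.Rank1Residual.Additive.smul_galH1Torsion_eq_zero`
-- (`Additive/RationalClassesToLayerZero.lean`); it is not restated here — the consumer imports it.

/-- `hL`: `p • x = 0` for every local class `x ∈ H¹(K_v, E[p])` (`E[p]` is killed by `p`;
`galoisCohomology.nsmul_eq_zero_of_forall`). [folklore] -/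
theorem nsmul_galoisCohomology_toLocal_eq_zero (v : Place K)
    (x : galoisCohomology ((W.torsionGaloisModule (p : ℤ)).toLocal v) 1) : p • x = 0 :=
  galoisCohomology.nsmul_eq_zero_of_forall _ (fun m => AddSubgroup.torsionBy.nsmul m) x

/-! ### §2. `hoff`: Kummer = residual at the Tamagawa-`p`-free places `v ∤ p` -/

section Off

variable [W.IsElliptic] [Fact p.Prime]

/-- `hoff` at a finite `v ∤ p` with `p ∤ c_v(E)`: the Kummer condition equals the residual (= unramified)
condition (team n1011 (L1), LOCAL). [cite: MilneADT2006, Ch. I Prop. 3.8 and Remark 3.10] -/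
theorem kummerSelmerStructure_eq_residualSelmerStructure_of_not_dvd {v : HeightOneSpectrum (𝓞 K)}
    (hv : (p : 𝓞 K) ∉ v.asIdeal)
    (hc : ¬ p ∣ (W.baseChange (v.adicCompletion K)).localTamagawaNumber (v.adicCompletionIntegers K)) :
    W.kummerSelmerStructure (p : ℤ) (Sum.inr v) = residualSelmerStructure W p (Sum.inr v) :=
  (residualSelmerStructure_eq_kummerSelmerStructure_of_not_dvd W p hv hc).symm

/-- `hoff` at a GOOD `v ∤ p` (`c_v = 1`). [cite: SilvermanAEC2009, Cor. X.4.4] -/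
theorem kummerSelmerStructure_eq_residualSelmerStructure_of_hasGoodReductionAt
    {v : HeightOneSpectrum (𝓞 K)} (hv : (p : 𝓞 K) ∉ v.asIdeal) (hgood : W.HasGoodReductionAt v) :
    W.kummerSelmerStructure (p : ℤ) (Sum.inr v) = residualSelmerStructure W p (Sum.inr v) :=
  kummerSelmerStructure_eq_residualSelmerStructure_of_not_dvd W p hv
    (not_dvd_localTamagawaNumber_of_hasGoodReductionAt W p hgood)

end Off

/-! ### §3. `hSel`: `Sel_p(E)` by membership relative to `S` -/

section Sel

variable [W.IsElliptic] [Fact p.Prime]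

/-- **`hSel`.** For a finite set of places `S` containing every archimedean place, every place above
`p` and every place of bad reduction: `c ∈ Sel_p(E)` iff `loc_v c` satisfies the Kummer condition at
every `v ∈ S` and the residual (= unramified) condition at every `v ∉ S`.
[cite: SilvermanAEC2009, Thm. X.4.2 and Cor. X.4.4] -/
theorem mem_selmerGroup_iff_of_places {S : Finset (Place K)}
    (hS : ∀ w : InfinitePlace K, (Sum.inl w : Place K) ∈ S)
    (hSp : ∀ v : HeightOneSpectrum (𝓞 K), (p : 𝓞 K) ∈ v.asIdeal → (Sum.inr v : Place K) ∈ S)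
    (hSbad : ∀ v : HeightOneSpectrum (𝓞 K), (Sum.inr v : Place K) ∉ S → W.HasGoodReductionAt v)
    (c : galH1Torsion W (p : ℤ)) :
    c ∈ W.selmerGroup (p : ℤ) ↔
      (∀ v ∈ S, galoisCohomology.localization (W.torsionGaloisModule (p : ℤ)) v 1 c ∈
          W.kummerSelmerStructure (p : ℤ) v) ∧
        ∀ v, v ∉ S → galoisCohomology.localization (W.torsionGaloisModule (p : ℤ)) v 1 c ∈
          residualSelmerStructure W p v := by
  rw [mem_selmerGroup_iff_forall_localization_mem]
  have key : ∀ v : Place K, v ∉ S → W.kummerSelmerStructure (p : ℤ) v = residualSelmerStructure W p v := by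
    rintro (w | v) hv
    · exact absurd (hS w) hv
    · exact kummerSelmerStructure_eq_residualSelmerStructure_of_hasGoodReductionAt W p
        (fun h => hv (hSp v h)) (hSbad v hv)
  refine ⟨fun h => ⟨fun v _ => h v, fun v hv => ?_⟩, fun h v => ?_⟩
  · rw [← key v hv]; exact h v
  · by_cases hv : v ∈ S
    · exact h.1 v hv
    · rw [key v hv]; exact h.2 v hv

end Sel

/-! ### §4. `hS0`: `S⁰(E)` by membership relative to `P` -/

section S0

variable [W.IsElliptic] [Fact p.Prime]

/-- **`hS0`.** For a finite set of places `P` (meant to contain every archimedean place and every place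
above `p`) all of whose finite members `v ∤ p` are Tamagawa-`p`-free: `c ∈ S⁰(E)` iff `loc_v c` satisfies
the Kummer condition at every `v ∈ P` and the residual condition at every `v ∉ P` (on `P` the two
conditions agree: by definition above `p` and at `∞`, by §2 at the Tamagawa-free places). [cite: MazurRubin2007, Def. 1.2] [cite: MilneADT2006, Ch. I Prop. 3.8 and Remark 3.10] -/
theorem mem_residualSelmerGroup_iff_of_places {P : Finset (Place K)}
    (hPtam : ∀ v : HeightOneSpectrum (𝓞 K), (Sum.inr v : Place K) ∈ P → (p : 𝓞 K) ∉ v.asIdeal →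
      ¬ p ∣ (W.baseChange (v.adicCompletion K)).localTamagawaNumber (v.adicCompletionIntegers K))
    (c : galH1Torsion W (p : ℤ)) :
    c ∈ residualSelmerGroup W p ↔
      (∀ v ∈ P, galoisCohomology.localization (W.torsionGaloisModule (p : ℤ)) v 1 c ∈
          W.kummerSelmerStructure (p : ℤ) v) ∧
        ∀ v, v ∉ P → galoisCohomology.localization (W.torsionGaloisModule (p : ℤ)) v 1 c ∈
          residualSelmerStructure W p v := by
  have key : ∀ v : Place K, v ∈ P → residualSelmerStructure W p v = W.kummerSelmerStructure (p : ℤ) v := by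
    rintro (w | v) hv
    · rfl
    · by_cases hpv : (p : 𝓞 K) ∈ v.asIdeal
      · exact residualSelmerStructure_inr_of_mem W p hpv
      · exact residualSelmerStructure_eq_kummerSelmerStructure_of_not_dvd W p hpv (hPtam v hv hpv)
  refine (((residualSelmerStructure W p).mem_selmerGroup_iff c :
    c ∈ (residualSelmerStructure W p).selmerGroup ↔ _)).trans ?_
  refine ⟨fun h => ⟨fun v hv => ?_, fun v _ => h v⟩, fun h v => ?_⟩
  · rw [← key v hv]; exact h v
  · by_cases hv : v ∈ P
    · rw [key v hv]; exact h.1 v hv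
    · exact h.2 v hv

end S0

/-! ### §5. `hfin`: the classes unramified outside `S` are finite (Silverman X.4.3) -/

section Fin

variable [W.IsElliptic] [Fact p.Prime]

/-- A class whose localisation at a good finite `v ∤ p` satisfies the residual (= unramified) condition
lies in Silverman's `unramifiedKer (E[p]) 𝔓` for every prime `𝔓 ∣ v` of `\bar ℤ_K` (n1011 (L1):
`𝓢_v = unramifiedKer 𝔓`, and `𝓢_v = res_v⁻¹ 𝓛_v = res_v⁻¹ H¹_ur`). [cite: SilvermanAEC2009, Cor. X.4.4 and Remark X.4.1.1] -/
theorem mem_unramifiedKer_of_localization_mem {v : HeightOneSpectrum (𝓞 K)} (hv : (p : 𝓞 K) ∉ v.asIdeal)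
    (hgood : W.HasGoodReductionAt v) {c : galH1Torsion W (p : ℤ)}
    (hc : galoisCohomology.localization (W.torsionGaloisModule (p : ℤ)) (Sum.inr v) 1 c ∈
      residualSelmerStructure W p (Sum.inr v))
    {𝔓 : Ideal (absIntegers (𝓞 K) K)} (h𝔓 : 𝔓 ∈ v.primesAbove) :
    c ∈ unramifiedKer (geomTorsion W (p : ℤ)) 𝔓 := by
  have hcv := not_dvd_localTamagawaNumber_of_hasGoodReductionAt W p hgood
  have hc' : galoisCohomology.localization (W.torsionGaloisModule (p : ℤ)) (Sum.inr v) 1 c ∈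
      W.kummerSelmerStructure (p : ℤ) (Sum.inr v) := by
    rw [kummerSelmerStructure_eq_residualSelmerStructure_of_not_dvd W p hv hcv]; exact hc
  have hsel : c ∈ selmerLocalKer W (v.adicCompletion K) (p : ℤ) := by
    rw [← selmerLocalKer_completion_inr, ← comap_localization_kummerSelmerStructure]
    exact hc'
  rwa [selmerLocalKer_eq_unramifiedKer_of_not_dvd_localTamagawaNumber W p hv hcv h𝔓] at hsel

/-- **`hfin`.** For a finite set of places `S` containing every place above `p` and every bad place
(and, in the application, every archimedean place), the classes of `H¹(K, E[p])` satisfying the residual condition at every `v ∉ S`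
are FINITE: they lie in `H¹(G_K, E[p]; S_fin)` (Silverman Lemma X.4.3, the tree's
`finite_h1Unramified_holds`; `E[p]` finite and discrete: `finite_torsionPoints_holds`,
`isOpen_stabilizer_point_holds`). [cite: SilvermanAEC2009, Lemma X.4.3] -/
theorem finite_residual_outside {S : Finset (Place K)}
    (hSp : ∀ v : HeightOneSpectrum (𝓞 K), (p : 𝓞 K) ∈ v.asIdeal → (Sum.inr v : Place K) ∈ S)
    (hSbad : ∀ v : HeightOneSpectrum (𝓞 K), (Sum.inr v : Place K) ∉ S → W.HasGoodReductionAt v) :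
    Finite {c : galH1Torsion W (p : ℤ) //
      ∀ v, v ∉ S → galoisCohomology.localization (W.torsionGaloisModule (p : ℤ)) v 1 c ∈
        residualSelmerStructure W p v} := by
  have hp0 : ((p : ℕ) : ℤ) ≠ 0 := by exact_mod_cast (Fact.out : p.Prime).ne_zero
  -- the finite set of FINITE places in `S`
  let T : Set (HeightOneSpectrum (𝓞 K)) := {v | (Sum.inr v : Place K) ∈ S}
  have hT : T.Finite :=
    (S.finite_toSet.preimage Sum.inr_injective.injOn).subset fun v hv => hv
  haveI : Finite (geomTorsion W (p : ℤ)) := W.finite_torsionPoints_holds (AlgebraicClosure K) hp0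
  haveI : ContinuousSMul (Field.absoluteGaloisGroup K) (geomTorsion W (p : ℤ)) :=
    continuousSMul_geomTorsion W W.isOpen_stabilizer_point_holds (p : ℤ)
  have hfin : Finite (h1Unramified (geomTorsion W (p : ℤ)) T) := finite_h1Unramified_holds K _ hT
  refine Finite.of_injective (fun c => (⟨c.1, ?_⟩ : h1Unramified (geomTorsion W (p : ℤ)) T)) ?_
  · rw [mem_h1Unramified_iff]
    intro v hv 𝔓 h𝔓
    exact mem_unramifiedKer_of_localization_mem W p (fun h => hv (hSp v h)) (hSbad v hv)
      (c.2 (Sum.inr v) hv) h𝔓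
  · intro c d h
    apply Subtype.ext
    simpa using congrArg Subtype.val h

end Fin

end Summit.BirchSwinnertonDyer.Rank1Residual.X10.ResidualSelmerGroupBinders

end
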